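import Summits.Schanuel.Schanuel.Theorems.RootDecomp1HSpineCell

/-!
# RootDecomp1HSpine — continuation (RootDecomp1HSpineSubst): §5 the instrument at an n-cycle: cyclic substitution and the tangent n-plane (substFunN … totalDegree_cycSubstN_le, SrcExclN, no_certificate_of_srcExclN, finCS_cell_of_srcExclN, bridge_cell_iffN)

Part of the six-file split (400-line rule) of lens 5's gen-11 node «CyclicSpine» = HOME/decomp-schanuel-lens-5/g11/Spine.lean
(sha256 ea4c5941…; ROUND 11 of route-Schanuel-RootDecomp1H, a THEOREM ROUND; `--supports stmt-Schanuel-30564`). All parts share the namespace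
`Summit.Schanuel.Schanuel.Theorems.RootDecomp1HSpine` and the header block of the node; the module docstring of the first part
(`RootDecomp1HSpineRigid`) describes the whole node. Sorry-free; standard axioms. Nothing here proves Schanuel; rung 0.
-/

set_option linter.dupNamespace false

noncomputable section

namespace Summit.Schanuel.Schanuel.Theorems.RootDecomp1HSpine

open Complex Set
open Literature.NumberTheory.Transcendental (exists_nsmul_mem_span_int mem_adjoin_of_mem_span_int SchanuelRank Khovanskii.ePD)
open Summit.Schanuel.Schanuel.Theses.RootDecomp1H (ProductSchanuel RelTowerSchanuel BridgeTransverse FinCS)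
open Summit.Schanuel.Schanuel.Theorems.RootDecomp1HTowerCells (trdeg_adjoin_adjoin_eq trdeg_adjoin_union_le
  trdeg_adjoin_range_le)
open Summit.Schanuel.Schanuel.Theorems.RootDecomp1HCurveHull
open Summit.Schanuel.Schanuel.Theorems.RootDecomp1HClearance (LowerRanks CounterEx InTowerHull)
open Summit.Schanuel.Schanuel.Theorems.RootDecomp1HWitness
open Summit.Schanuel.Schanuel.Theorems.RootDecomp1HGauge
open Summit.Schanuel.Schanuel.Theorems.RootDecomp1HCycles (ratCast_mem mem_closure_of_isAlgebraic_closure mem_closure_of_pair)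

/-! ## 5. The instrument at an `n`-cycle: the cyclic substitution and the tangent `n`-plane -/

section instrument

variable {n : ℕ} [NeZero n] (ε c : Fin n → ℤ)

/-- Images of the `2n` variables under the CYCLIC SUBSTITUTION `X_j ↦ ε_{j−1} U_{j−1} + c_{j−1}`, `Y_j ↦ U_j`. -/
def substFunN : Fin n ⊕ Fin n → MvPolynomial (Fin n) ℤ :=
  Sum.elim (fun j => MvPolynomial.C (ε (j - 1)) * MvPolynomial.X (j - 1) + MvPolynomial.C (c (j - 1)))
    (fun j => MvPolynomial.X j)

/-- The cyclic substitution `ℤ[X, Y] → ℤ[U]`. -/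
def cycSubstN : MvPolynomial (Fin n ⊕ Fin n) ℤ →ₐ[ℤ] MvPolynomial (Fin n) ℤ := MvPolynomial.aeval (substFunN ε c)

/-- Re-embedding `ℤ[U] → ℤ[X, Y]`, `U_j ↦ Y_j`. -/
def reembedN : MvPolynomial (Fin n) ℤ →ₐ[ℤ] MvPolynomial (Fin n ⊕ Fin n) ℤ := MvPolynomial.rename Sum.inr

/-- The cycle equations as integer polynomials: `ℓ_j = X_{j+1} − ε_j Y_j − c_j`. -/
def ellN (j : Fin n) : MvPolynomial (Fin n ⊕ Fin n) ℤ :=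
  MvPolynomial.X (Sum.inl (j + 1)) - MvPolynomial.C (ε j) * MvPolynomial.X (Sum.inr j) - MvPolynomial.C (c j)

/-- The GRADIENT of an integer polynomial at the point `(y, e^y)` (as in `IsCertificate`). -/
def gradN (P : MvPolynomial (Fin n ⊕ Fin n) ℤ) (y : Fin n → ℂ) : Fin n ⊕ Fin n → ℂ :=
  fun s => MvPolynomial.aeval (Sum.elim y (cexp ∘ y)) (MvPolynomial.pderiv s P)

/-- The TANGENT `n`-PLANE: the `ℂ`-span of the gradients of the `n` cycle equations. -/
def tangentPlaneN (y : Fin n → ℂ) : Submodule ℂ (Fin n ⊕ Fin n → ℂ) :=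
  Submodule.span ℂ (Set.range fun j => gradN (ellN ε c j) y)

/-- SOURCE EXCLUSION AT SIZE `N`: every integer polynomial of size `≤ N` whose cyclic image vanishes at `u` has ZERO image. -/
def SrcExclN (u : Fin n → ℂ) (N : ℕ) : Prop :=
  ∀ P : MvPolynomial (Fin n ⊕ Fin n) ℤ, psize P ≤ N → MvPolynomial.aeval u (cycSubstN ε c P) = 0 → cycSubstN ε c P = 0

variable {ε c} {y : Fin n → ℂ}

/-- The cyclic substitution on a source variable `X_j`: `X_j ↦ ε_{j−1} U_{j−1} + c_{j−1}`. -/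
theorem substFunN_inl (j : Fin n) :
    substFunN ε c (Sum.inl j) = MvPolynomial.C (ε (j - 1)) * MvPolynomial.X (j - 1) + MvPolynomial.C (c (j - 1)) := rfl

/-- `substFunN ε c (Sum.inr j) = MvPolynomial.X j`. -/
theorem substFunN_inr (j : Fin n) : substFunN ε c (Sum.inr j) = MvPolynomial.X j := rfl

/-- The substitution evaluates correctly at a cycle: `(substFunN s)(u) = (y, e^y)_s`. -/
theorem aeval_substFunN (h : IsIntCycleN ε c y) (s : Fin n ⊕ Fin n) :
    MvPolynomial.aeval (cexp ∘ y) (substFunN ε c s) = Sum.elim y (cexp ∘ y) s := by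
  rcases s with j | j
  · rw [substFunN_inl, Sum.elim_inl, map_add, map_mul, MvPolynomial.aeval_C, MvPolynomial.aeval_C, MvPolynomial.aeval_X]
    have := h (j - 1)
    rw [sub_add_cancel] at this
    rw [this]; simp
  · rw [substFunN_inr]; simp

/-- `(cycSubstN P)(u) = P(y, e^y)`. -/
theorem aeval_cycSubstN (h : IsIntCycleN ε c y) (P : MvPolynomial (Fin n ⊕ Fin n) ℤ) :
    MvPolynomial.aeval (cexp ∘ y) (cycSubstN ε c P) = MvPolynomial.aeval (Sum.elim y (cexp ∘ y)) P := by
  have hcomp := MvPolynomial.comp_aeval (R := ℤ) (f := substFunN ε c)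
    (MvPolynomial.aeval (cexp ∘ y) : MvPolynomial (Fin n) ℤ →ₐ[ℤ] ℂ)
  have h2 : (fun i => MvPolynomial.aeval (cexp ∘ y) (substFunN ε c i)) = Sum.elim y (cexp ∘ y) :=
    funext (aeval_substFunN h)
  rw [h2] at hcomp
  exact AlgHom.congr_fun hcomp P

omit [NeZero n] in
/-- `(reembedN G)(y, e^y) = G(u)`. -/
theorem aeval_reembedN (G : MvPolynomial (Fin n) ℤ) :
    MvPolynomial.aeval (Sum.elim y (cexp ∘ y)) (reembedN G) = MvPolynomial.aeval (cexp ∘ y) G := by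
  rw [reembedN, MvPolynomial.aeval_rename, Sum.elim_comp_inr]

omit [NeZero n] in
/-- `gradN (P + Q) y = gradN P y + gradN Q y`. -/
theorem gradN_add (P Q : MvPolynomial (Fin n ⊕ Fin n) ℤ) : gradN (P + Q) y = gradN P y + gradN Q y := by
  funext s; simp [gradN]

omit [NeZero n] in
/-- `gradN (P - Q) y = gradN P y - gradN Q y`. -/
theorem gradN_sub (P Q : MvPolynomial (Fin n ⊕ Fin n) ℤ) : gradN (P - Q) y = gradN P y - gradN Q y := by
  funext s; simp [gradN]

omit [NeZero n] in
/-- `gradN (0 : MvPolynomial (Fin n ⊕ Fin n) ℤ) y = 0`. -/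
theorem gradN_zero : gradN (0 : MvPolynomial (Fin n ⊕ Fin n) ℤ) y = 0 := by
  funext s; simp [gradN]

omit [NeZero n] in
/-- `gradN (MvPolynomial.C a : MvPolynomial (Fin n ⊕ Fin n) ℤ) y = 0`. -/
theorem gradN_C (a : ℤ) : gradN (MvPolynomial.C a : MvPolynomial (Fin n ⊕ Fin n) ℤ) y = 0 := by
  funext s; simp [gradN]

omit [NeZero n] in
/-- Leibniz. -/
theorem gradN_mul (P Q : MvPolynomial (Fin n ⊕ Fin n) ℤ) :
    gradN (P * Q) y = MvPolynomial.aeval (Sum.elim y (cexp ∘ y)) P • gradN Q y +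
      MvPolynomial.aeval (Sum.elim y (cexp ∘ y)) Q • gradN P y := by
  funext s
  simp only [gradN, MvPolynomial.pderiv_mul, map_add, map_mul, Pi.add_apply, Pi.smul_apply, smul_eq_mul]
  ring

/-- The re-embedded image of `X_j` differs from `X_j` by the cycle equation `ℓ_{j−1}`. -/
theorem X_inl_sub_reembedN (j : Fin n) :
    MvPolynomial.X (Sum.inl j) - reembedN (cycSubstN ε c (MvPolynomial.X (Sum.inl j))) = ellN ε c (j - 1) := by
  rw [cycSubstN, MvPolynomial.aeval_X, substFunN_inl, reembedN, map_add, map_mul, MvPolynomial.rename_C,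
    MvPolynomial.rename_C, MvPolynomial.rename_X, ellN, sub_add_cancel]
  ring

/-- The exponential variables `Y_j` are fixed by substitution followed by re-embedding. -/
theorem X_inr_sub_reembedN (j : Fin n) :
    MvPolynomial.X (Sum.inr j) - reembedN (cycSubstN ε c (MvPolynomial.X (Sum.inr j))) = 0 := by
  rw [cycSubstN, MvPolynomial.aeval_X, substFunN_inr, reembedN, MvPolynomial.rename_X, sub_self]

/-- **THE TANGENT LEMMA** (Leibniz induction): for every integer polynomial `P`, the gradient of `P` at `(y, e^y)` differs
from the gradient of the re-embedded cyclic image by a vector of the tangent `n`-plane. -/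
theorem gradN_sub_gradN_reembed_mem (h : IsIntCycleN ε c y) (P : MvPolynomial (Fin n ⊕ Fin n) ℤ) :
    gradN P y - gradN (reembedN (cycSubstN ε c P)) y ∈ tangentPlaneN ε c y := by
  induction P using MvPolynomial.induction_on with
  | C a =>
    rw [cycSubstN, MvPolynomial.aeval_C, reembedN, MvPolynomial.algebraMap_eq, MvPolynomial.rename_C, gradN_C, sub_zero]
    exact zero_mem _
  | add p q hp hq =>
    rw [map_add, map_add, gradN_add, gradN_add, add_sub_add_comm]
    exact add_mem hp hq
  | mul_X p s hp =>
    have hval : ∀ Q : MvPolynomial (Fin n ⊕ Fin n) ℤ,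
        MvPolynomial.aeval (Sum.elim y (cexp ∘ y)) (reembedN (cycSubstN ε c Q)) =
          MvPolynomial.aeval (Sum.elim y (cexp ∘ y)) Q := fun Q => by
      rw [aeval_reembedN, aeval_cycSubstN h]
    have hX : gradN (MvPolynomial.X s : MvPolynomial (Fin n ⊕ Fin n) ℤ) y -
        gradN (reembedN (cycSubstN ε c (MvPolynomial.X s))) y ∈ tangentPlaneN ε c y := by
      rw [← gradN_sub]
      rcases s with j | j
      · rw [X_inl_sub_reembedN]; exact Submodule.subset_span ⟨j - 1, rfl⟩
      · rw [X_inr_sub_reembedN, gradN_zero]; exact zero_mem _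
    rw [map_mul, map_mul, gradN_mul, gradN_mul, hval, hval]
    convert add_mem (Submodule.smul_mem _ (MvPolynomial.aeval (Sum.elim y (cexp ∘ y)) p) hX)
      (Submodule.smul_mem _ (MvPolynomial.aeval (Sum.elim y (cexp ∘ y)) (MvPolynomial.X s : MvPolynomial _ ℤ)) hp)
      using 1
    rw [smul_sub, smul_sub]; abel

/-- **IN THE KERNEL ⟹ TANGENT**: an integer polynomial with ZERO cyclic image has its gradient at `(y, e^y)` in the tangent
`n`-plane. -/
theorem gradN_mem_of_cycSubstN_eq_zero (h : IsIntCycleN ε c y) {P : MvPolynomial (Fin n ⊕ Fin n) ℤ}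
    (hP : cycSubstN ε c P = 0) : gradN P y ∈ tangentPlaneN ε c y := by
  have := gradN_sub_gradN_reembed_mem h P
  rwa [hP, map_zero, gradN_zero, sub_zero] at this

/-- **NO SMALL CERTIFICATE AT AN EXCLUDED CYCLE**: if every size-`≤ N` integer polynomial with cyclic image vanishing at
`u = e^y` has zero image, then no transverse integer certificate of size `≤ N` exists at `y` (`n + 1` gradients in an
`n`-plane). -/
theorem no_certificate_of_srcExclN (h : IsIntCycleN ε c y) {N : ℕ} (hex : SrcExclN ε c (cexp ∘ y) N) :
    ¬ ∃ P : Fin (n + 1) → MvPolynomial (Fin n ⊕ Fin n) ℤ, (∀ i, psize (P i) ≤ N) ∧ IsCertificate n y P := by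
  rintro ⟨P, hsize, hzero, hli⟩
  have hmem : ∀ i, gradN (P i) y ∈ tangentPlaneN ε c y := fun i =>
    gradN_mem_of_cycSubstN_eq_zero h (hex (P i) (hsize i) (by rw [aeval_cycSubstN h]; exact hzero i))
  haveI : FiniteDimensional ℂ (tangentPlaneN ε c y) := FiniteDimensional.span_of_finite ℂ (Set.finite_range _)
  have hV : Module.finrank ℂ (tangentPlaneN ε c y) ≤ n :=
    (finrank_range_le_card (R := ℂ) (fun j : Fin n => gradN (ellN ε c j) y)).trans (by simp)
  let b : Fin (n + 1) → tangentPlaneN ε c y := fun i => ⟨gradN (P i) y, hmem i⟩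
  have hb : LinearIndependent ℂ b := LinearIndependent.of_comp (tangentPlaneN ε c y).subtype hli
  have h4 := hb.fintype_card_le_finrank
  rw [Fintype.card_fin] at h4
  omega

/-- **THE INSTRUMENT INSTANCE AT AN EXCLUDED CYCLE**: the `(n, 1, y)`-instance of `FinCSAt g` holds (second disjunct) as soon
as `SrcExclN ε c (e^y) (g n 1)` is certified — whatever the status of `LowerRanks n`, near-optimality or conjugation-stability. -/
theorem finCS_cell_of_srcExclN (h : IsIntCycleN ε c y) {g : ℕ → ℕ → ℕ} (hex : SrcExclN ε c (cexp ∘ y) (g n 1)) :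
    LowerRanks n → NearOpt n 1 y → ConjStable y →
      (¬ LinearIndependent ℚ y ∨
        ¬ ∃ P : Fin (n + 1) → MvPolynomial (Fin n ⊕ Fin n) ℤ, (∀ i, psize (P i) ≤ g n 1) ∧ IsCertificate n y P) :=
  fun _ _ _ => Or.inr (no_certificate_of_srcExclN h hex)

/-- **THE RESIDUAL AT AN EXCLUDED CYCLE, READ EXACTLY.**  At a near-optimal conjugation-stable cycle off the hull with
`SrcExclN` certified, the `(n, 1, y)`-instance of `BridgeAt g` (for `g = stdGauge`: of `BridgeTransverse`) is equivalent to
«`LowerRanks n →` `y` is not a counterexample», i.e. to Schanuel's inequality at `y` given Schanuel in ranks `< n`. -/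
theorem bridge_cell_iffN (h : IsIntCycleN ε c y) {g : ℕ → ℕ → ℕ} (hex : SrcExclN ε c (cexp ∘ y) (g n 1))
    (hopt : NearOpt n 1 y) (hcs : ConjStable y) (hnh : ¬ InTowerHull y) :
    (LowerRanks n → NearOpt n 1 y → ConjStable y → CounterEx y → ¬ InTowerHull y →
        ∃ P : Fin (n + 1) → MvPolynomial (Fin n ⊕ Fin n) ℤ, (∀ i, psize (P i) ≤ g n 1) ∧ IsCertificate n y P) ↔
      (LowerRanks n → ¬ CounterEx y) := by
  constructor
  · exact fun hB hlow hce => no_certificate_of_srcExclN h hex (hB hlow hopt hcs hce hnh)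
  · exact fun hN hlow _ _ hce _ => absurd hce (hN hlow)

/-- `y` is a counterexample iff it is `ℚ`-free with `trdeg ℚ(e^{y_0}, …, e^{y_{n−1}}) < n`. -/
theorem counterEx_cycleN_iff {r c' : Fin n → ℚ} (h : IsCycleN r c' y) :
    CounterEx y ↔ LinearIndependent ℚ y ∧
      Algebra.trdeg ℚ ↥(IntermediateField.adjoin ℚ (range (cexp ∘ y))) < (n : Cardinal) := by
  have key : Algebra.trdeg ℚ ↥(IntermediateField.adjoin ℚ (range y ∪ range (cexp ∘ y))) =
      Algebra.trdeg ℚ ↥(IntermediateField.adjoin ℚ (range (cexp ∘ y))) :=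
    congrArg (fun F : IntermediateField ℚ ℂ => Algebra.trdeg ℚ ↥F) h.adjoin_cycle_eq
  unfold CounterEx
  rw [key]

/-- Images under the cyclic substitution do not increase the total degree. -/
theorem totalDegree_substFunN_le (s : Fin n ⊕ Fin n) : (substFunN ε c s).totalDegree ≤ 1 := by
  rcases s with j | j
  · rw [substFunN_inl]
    refine (MvPolynomial.totalDegree_add _ _).trans (max_le ?_ ?_)
    · exact (MvPolynomial.totalDegree_mul _ _).trans
        (by rw [MvPolynomial.totalDegree_C, MvPolynomial.totalDegree_X, zero_add])
    · rw [MvPolynomial.totalDegree_C]; exact zero_le_one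
  · rw [substFunN_inr, MvPolynomial.totalDegree_X]

/-- The cyclic substitution does not raise the total degree. -/
theorem totalDegree_cycSubstN_le (P : MvPolynomial (Fin n ⊕ Fin n) ℤ) :
    (cycSubstN ε c P).totalDegree ≤ P.totalDegree := by
  classical
  rw [cycSubstN, MvPolynomial.aeval_eq_eval₂Hom, MvPolynomial.coe_eval₂Hom, MvPolynomial.eval₂_eq']
  refine MvPolynomial.totalDegree_finsetSum_le fun d hd => (MvPolynomial.totalDegree_mul _ _).trans ?_
  rw [MvPolynomial.algebraMap_eq, MvPolynomial.totalDegree_C, zero_add]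
  refine (MvPolynomial.totalDegree_finsetProd _ _).trans ?_
  calc ∑ i, (substFunN ε c i ^ d i).totalDegree ≤ ∑ i, d i := Finset.sum_le_sum fun i _ =>
          (MvPolynomial.totalDegree_pow _ _).trans (by simpa using Nat.mul_le_mul_left (d i) (totalDegree_substFunN_le i))
    _ = d.sum fun _ e => e := by rw [Finsupp.sum_fintype _ _ (fun _ => rfl)]
    _ ≤ P.totalDegree := MvPolynomial.le_totalDegree hd

end instrument

end Summit.Schanuel.Schanuel.Theorems.RootDecomp1HSpine
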